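import Summits.AtomisticToContinuum.Crystallization.Theorems.ChargedEnergyGapDeepRigidity

/-!
# `PricedLinkCensus.ChargedEnergyGap` (stmt-AtomisticToContinuum-14231) — the REACH dial on the deep-rigid residual
# (decomp-a2c lens 3, generation 45; part G, over part F-B `ChargedEnergyGapDeepRigidity`; critic row 881 docket (1), typed frame)

The G-side line of record is `ChargedEnergyGap ⟸ [P] ∧ IP ∧ DRP` (`grossChargeGap_iff_improvable_deepRigid_record`, part F-B), residual
DRP `DeepRigidPricing (3/20) (1/10) (6/5) 10 (1/100)`: `κ` per compact gross charged motif site that is `(10, 1/100)`-rigid in its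
presentation and in all large supercells.  On the known zoo its inhabitants are of TWO physical kinds with two different pricing engines:
(T) cores of topological defects of a CRYSTAL — grain boundaries, dislocations, incoherent twins, prismatic faults — priced by interface /
incompatibility energy (Read–Shockley: a low-angle wall of misorientation `ϑ` costs `ϑ(A + B log(1/ϑ))` per area against `∝ ϑ` core sites
per area, so the price per CORE site does not degenerate — the cell's negative finding «interface pricing FALSE locally» (lens-4 NF4) is about
pricing BALLS along the wall, not cores); (U) sites deep inside FRUSTRATED matter (no charge-free particle anywhere near), priced only by a
bulk total-frustration gap below the nucleation radius — the `TetrahedralFrustration` regime.  Every cut of the residual so far reads the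
site ITSELF (shell, chart, binding, holes, improvability); this file cuts it by the GEOMETRY OF ITS SURROUNDINGS.

§1 `CrystalWithin L Q p`: some CHARGE-FREE point of `Q` (tolerance `1/100`) within distance `L` of the point `p` of space.  Only reads the
   point set (`crystalWithin_congr_points`), invariant under the periods (`crystalWithin_add_period`), monotone in `L`, empty for `L < 0`;
   under the P-side dictionary `ChargeFreeCharted θ` it hands every such `p` a `θ`-CHARTED point within `L` — a chart FRAME within reach
   (`exists_charted_within`), the hook of the incompatibility engine.  Every point of `Q` within `L` of a point WITHOUT crystal within reach
   is charged (`not_isChargeFree_of_near_frustrated`): frustrated cores come in fully charged `L`-balls.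
§2 THE REACH SPLIT (exact, every `θ ε R r η L`): deep-rigid = INTERFACIAL (crystal within reach) + FRUSTRATED (none),
   `motifCompactDeepRigid_eq_frustrated_add_interfacial`; ★ `deepRigidPricing_iff_frustrated_interfacial : DRP ⟺ FCP ∧ ICP`; both pieces
   WEAKER than DRP (proved), ICP antitone and FCP monotone in `L`, `FCP L ⟺ DRP` for `L < 0` (dial end).
§3 THE ONE-WAY DEBIT.  IDP `InterfacialDebitPricing`: interfacial cores priced up to a debit `C` per FRUSTRATED core — the shape in which an
   elastic / incompatibility certificate over «crystal + its defects» can hold, leaking only where the crystal ends in frustrated bulk.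
   ★ `interfacialCorePricing_of_debit_frustrated : IDP → FCP → ICP` (constant `κκ'/(κ' + C)`), hence ★ `deepRigidPricing_iff_debit_frustrated :
   DRP ⟺ IDP ∧ FCP` (exact).  WHY THIS DEBIT AND NO OTHER: the P-side piece `ChartedChargePricing` carries a debit per gross site, so a G-side
   piece debited back onto charted-charged sites would close only under the unprovable constant condition `κ_P κ_G > C_P C_G`; a debit onto the
   debit-free G-side piece FCP closes unconditionally (this theorem).  IDP is antitone in `L`.
§4 Cones by name (`chargedEnergyGap_of_reachDial[_regime]`), the record `r = 10`, `L = 40`: ★ `grossChargeGap_iff_improvable_debit_frustrated_record :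
   [G] ⟺ IP ∧ IDP ∧ FCP`, the five-leaf record cone `chargedEnergyGap_of_reachDial_record`, WEAKER certificates from the crux, and the dense end
   of FCP below the dense end of DRP (`universalCompetitor_frustrated_of_deepRigid`).

TAGS (pieces at the record `(θ, ε, R, r, η, L) = (3/20, 1/10, 6/5, 10, 1/100, 40)`; `L = 40` because charge at tolerance `1/100` is lost under
`≈ 1/200` deviatoric strain, so an isolated dislocation core sees charge-free crystal only beyond `≈ b/(4π·0.005) ≈ 16` spacings).
ICP `InterfacialCorePricing` · WEAKER than DRP (proved, sub-species) · TRUE-type on the zoo (Σ5–Σ7 walls, dislocation dipoles, stacking-fault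
  tetrahedra, prismatic faults: excess per core site `10⁻³ … 0.5`; low-angle limit safe, see above) · UNDECIDED in general — test: census
  L3-RIG-deep restricted to inhabitants WITH a charge-free particle within `40` (new ask L3-REACH) · IDEA-NEEDED: incompatibility pricing over the
  chart frames within reach (Read–Shockley; Lauteri–Luckhaus arXiv:1608.06155; Garroni–Leoni–Ponsiglione JEMS 2010; geometric rigidity
  Friesecke–James–Müller CPAM 2002) · why it might fail: a mechanically stable non-Barlow LAYER of thickness between `r` and `2L` inside crystal,
  within `≈ 0.015` per site of `e*` — interfacial by reach, bulk by mechanism, and no frustrated core to debit (none in the zoo).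
IDP `InterfacialDebitPricing` · WEAKER than ICP (proved, `C = 0`) · the ENGINE-SHAPED form of ICP (same tags) · exact partner of FCP.
FCP `FrustratedCorePricing` · WEAKER than DRP (proved) · ★ DECLARED SUB-RESIDUAL of the G-side · BARRIER-ringed: `TetrahedralFrustration` (a
  debit-free price on cores of frustrated `L`-balls is a total-frustration gap for sub-nucleation frustrated matter; icosahedral order beats
  Barlow per site, so no site-wise certificate — LocalCertificateBarrier) · UNDECIDED — test: census L3-NUC (nucleation radii) + L3-REACH;
  CONJECTURALLY VACUOUS at `r = 10`, `L = 40`: an inhabitant needs a mechanically stable non-Barlow arrangement filling a `40`-ball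
  within `≈ 3γ/(ρ r) ≈ 0.03` per site of `e*` (zoo floor: bcc `+0.031`, shear-unstable) · INSTRUMENTABLE · dense end below UC(deep-rigid)
  below `TotalFrustrationGap`'s ladder.
WHY NOVEL.  First cut of the residual by the surroundings rather than the site; it separates the two engines and is the only debit structure
on the G-side that provably closes against the P-side's debit.  WHY EACH PIECE IS STRICTLY WEAKER: ICP / FCP price sub-species of the DRP species
(count split); IDP is ICP with a debit.  All `[this work]`; uses `natCard_subtype_split`, `speciesPricing_add_iff`, `isChargeFree_add_period`.
-/

noncomputable section

open scoped Classical
open Literature.MathematicalPhysics.StatisticalMechanics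
open Literature.Geometry.DiscreteGeometry
open Summit.AtomisticToContinuum.Crystallization.Theses.PricedLinkCensus
open Summit.AtomisticToContinuum.Crystallization.Theorems.ChargedEnergyGapNegative

namespace Summit.AtomisticToContinuum.Crystallization.Theorems.ChargedEnergyGapChartDial

/-! ## §1 Crystal within reach -/

/-- **CRYSTAL WITHIN REACH `L`** of a point `p` of space: some charge-free point of `Q` (tolerance `1/100`) within distance `L` of `p`. -/
def CrystalWithin (L : ℝ) (Q : PeriodicConfiguration 3) (p : E3) : Prop :=
  ∃ q : E3, ∃ hq : q ∈ Q.points, IsChargeFree (1 / 100) (Subtype.val : Q.points → E3) ⟨q, hq⟩ ∧ dist p q ≤ L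

/-- Reach is monotone in `L`. -/
theorem CrystalWithin.mono {L L' : ℝ} (h : L ≤ L') {Q : PeriodicConfiguration 3} {p : E3} (hp : CrystalWithin L Q p) :
    CrystalWithin L' Q p := by
  obtain ⟨q, hq, hc, hd⟩ := hp
  exact ⟨q, hq, hc, hd.trans h⟩

/-- Dial end: nothing is within a negative reach. -/
theorem not_crystalWithin_of_neg {L : ℝ} (hL : L < 0) (Q : PeriodicConfiguration 3) (p : E3) : ¬ CrystalWithin L Q p :=
  fun ⟨_, _, _, hd⟩ => (not_le.2 hL) (dist_nonneg.trans hd)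

/-- A charge-free point of `Q` has crystal within every reach `L ≥ 0` (itself). -/
theorem crystalWithin_of_isChargeFree {L : ℝ} (hL : 0 ≤ L) {Q : PeriodicConfiguration 3} {q : E3} (hq : q ∈ Q.points)
    (hc : IsChargeFree (1 / 100) (Subtype.val : Q.points → E3) ⟨q, hq⟩) : CrystalWithin L Q q :=
  ⟨q, hq, hc, by rwa [dist_self]⟩

/-- ★ **Frustrated cores come in fully charged balls**: every point of `Q` within `L` of a point without crystal within reach is charged. -/
theorem not_isChargeFree_of_near_frustrated {L : ℝ} {Q : PeriodicConfiguration 3} {p : E3} (hp : ¬ CrystalWithin L Q p)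
    {q : E3} (hq : q ∈ Q.points) (hd : dist p q ≤ L) : ¬ IsChargeFree (1 / 100) (Subtype.val : Q.points → E3) ⟨q, hq⟩ :=
  fun hc => hp ⟨q, hq, hc, hd⟩

/-- ★ Reach is invariant under the periods of `Q` (translate the charge-free witness; charge is period invariant, part F-A). -/
theorem crystalWithin_add_period (L : ℝ) (Q : PeriodicConfiguration 3) {g : E3} (hg : g ∈ Q.lattice) (p : E3) :
    CrystalWithin L Q (p + g) ↔ CrystalWithin L Q p := by
  constructor
  · rintro ⟨q, hq, hc, hd⟩
    have hg' : -g ∈ Q.lattice := Q.lattice.neg_mem hg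
    have hqg : q + -g ∈ Q.points := Q.add_mem_points hq hg'
    refine ⟨q + -g, hqg, (isChargeFree_add_period (1 / 100) Q hg' hq hqg).2 hc, ?_⟩
    have h1 : dist p (q + -g) = dist (p + g) q := by
      rw [dist_eq_norm, dist_eq_norm]; congr 1; abel
    rwa [h1]
  · rintro ⟨q, hq, hc, hd⟩
    have hqg : q + g ∈ Q.points := Q.add_mem_points hq hg
    exact ⟨q + g, hqg, (isChargeFree_add_period (1 / 100) Q hg hq hqg).2 hc, by rwa [dist_add_right]⟩

/-- ★ Reach only reads the point set: two presentations of one point set have the same reach predicate. -/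
theorem crystalWithin_congr_points (L : ℝ) {P Q : PeriodicConfiguration 3} (h : P.points = Q.points) (p : E3) :
    CrystalWithin L P p ↔ CrystalWithin L Q p := by
  simp only [CrystalWithin]
  rw [h]

/-- In a supercell presentation (part F-A `IsSupercell`) reach is read exactly as in the original presentation. -/
theorem crystalWithin_of_isSupercell {k : ℕ} {Q P : PeriodicConfiguration 3} (hS : IsSupercell k Q P) (L : ℝ) (p : E3) :
    CrystalWithin L P p ↔ CrystalWithin L Q p :=
  crystalWithin_congr_points L hS.1 p

/-- ★ **The chart hook**: under the P-side dictionary `ChargeFreeCharted θ`, crystal within reach hands a `θ`-CHARTED point of `Q` (an fcc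
or hcp frame) within `L` — the datum an incompatibility certificate starts from. -/
theorem exists_charted_within {θ L : ℝ} (hD : ChargeFreeCharted θ) {Q : PeriodicConfiguration 3} {p : E3} (hp : CrystalWithin L Q p) :
    ∃ q : E3, ∃ hq : q ∈ Q.points, ChartedAt θ Q ⟨q, hq⟩ ∧ dist p q ≤ L := by
  obtain ⟨q, hq, hc, hd⟩ := hp
  exact ⟨q, hq, hD Q ⟨q, hq⟩ hc, hd⟩

/-! ## §2 The reach split of the deep-rigid residual -/

/-- Number of INTERFACIAL deep-rigid cores: compact gross charged motif sites, `(r, η)`-rigid and not deeply improvable, WITH crystal within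
reach `L`. -/
def motifCoreInterfacial (θ ε R r η L : ℝ) (Q : PeriodicConfiguration 3) : ℕ :=
  Nat.card {x : Q.motif //
    ((((Charged Q x ∧ ¬ ChartedAt θ Q (pt Q x)) ∧ ¬ Exposed ε R Q x) ∧ ¬ Improvable r η Q x) ∧ ¬ DeepImprovable r η Q x) ∧
      CrystalWithin L Q (x : E3)}

/-- Number of FRUSTRATED deep-rigid cores: the same species WITHOUT crystal within reach `L` (the declared sub-residual's species). -/
def motifCoreFrustrated (θ ε R r η L : ℝ) (Q : PeriodicConfiguration 3) : ℕ :=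
  Nat.card {x : Q.motif //
    ((((Charged Q x ∧ ¬ ChartedAt θ Q (pt Q x)) ∧ ¬ Exposed ε R Q x) ∧ ¬ Improvable r η Q x) ∧ ¬ DeepImprovable r η Q x) ∧
      ¬ CrystalWithin L Q (x : E3)}

/-- ★ deep-rigid = frustrated + interfacial, every reach `L`. -/
theorem motifCompactDeepRigid_eq_frustrated_add_interfacial (θ ε R r η L : ℝ) (Q : PeriodicConfiguration 3) :
    motifCompactDeepRigid θ ε R r η Q = motifCoreFrustrated θ ε R r η L Q + motifCoreInterfacial θ ε R r η L Q :=
  natCard_subtype_split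
    (fun x : Q.motif =>
      (((Charged Q x ∧ ¬ ChartedAt θ Q (pt Q x)) ∧ ¬ Exposed ε R Q x) ∧ ¬ Improvable r η Q x) ∧ ¬ DeepImprovable r η Q x)
    (fun x => CrystalWithin L Q (x : E3))

/-- Interfacial cores are deep-rigid sites. -/
theorem motifCoreInterfacial_le (θ ε R r η L : ℝ) (Q : PeriodicConfiguration 3) :
    motifCoreInterfacial θ ε R r η L Q ≤ motifCompactDeepRigid θ ε R r η Q := by
  rw [motifCompactDeepRigid_eq_frustrated_add_interfacial θ ε R r η L Q]; exact Nat.le_add_left _ _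

/-- Frustrated cores are deep-rigid sites. -/
theorem motifCoreFrustrated_le (θ ε R r η L : ℝ) (Q : PeriodicConfiguration 3) :
    motifCoreFrustrated θ ε R r η L Q ≤ motifCompactDeepRigid θ ε R r η Q := by
  rw [motifCompactDeepRigid_eq_frustrated_add_interfacial θ ε R r η L Q]; exact Nat.le_add_right _ _

/-- The interfacial count grows with the reach. -/
theorem motifCoreInterfacial_mono {θ ε R r η L L' : ℝ} (h : L ≤ L') (Q : PeriodicConfiguration 3) :
    motifCoreInterfacial θ ε R r η L Q ≤ motifCoreInterfacial θ ε R r η L' Q :=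
  Nat.card_le_card_of_injective (fun x => ⟨x.1, x.2.1, x.2.2.mono h⟩) fun _ _ hab => Subtype.ext (Subtype.mk.inj hab)

/-- The frustrated count shrinks with the reach. -/
theorem motifCoreFrustrated_anti {θ ε R r η L L' : ℝ} (h : L ≤ L') (Q : PeriodicConfiguration 3) :
    motifCoreFrustrated θ ε R r η L' Q ≤ motifCoreFrustrated θ ε R r η L Q :=
  Nat.card_le_card_of_injective (fun x => ⟨x.1, x.2.1, fun h0 => x.2.2 (h0.mono h)⟩)
    fun _ _ hab => Subtype.ext (Subtype.mk.inj hab)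

/-- Dial end: no interfacial core within a negative reach. -/
theorem motifCoreInterfacial_eq_zero_of_neg {θ ε R r η L : ℝ} (hL : L < 0) (Q : PeriodicConfiguration 3) :
    motifCoreInterfacial θ ε R r η L Q = 0 := by
  haveI : IsEmpty {x : Q.motif //
      ((((Charged Q x ∧ ¬ ChartedAt θ Q (pt Q x)) ∧ ¬ Exposed ε R Q x) ∧ ¬ Improvable r η Q x) ∧ ¬ DeepImprovable r η Q x) ∧
        CrystalWithin L Q (x : E3)} :=
    ⟨fun x => not_crystalWithin_of_neg hL Q _ x.2.2⟩
  exact Nat.card_of_isEmpty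

/-- Dial end: within a negative reach every deep-rigid site is a frustrated core. -/
theorem motifCoreFrustrated_eq_of_neg {θ ε R r η L : ℝ} (hL : L < 0) (Q : PeriodicConfiguration 3) :
    motifCoreFrustrated θ ε R r η L Q = motifCompactDeepRigid θ ε R r η Q := by
  rw [motifCompactDeepRigid_eq_frustrated_add_interfacial θ ε R r η L Q, motifCoreInterfacial_eq_zero_of_neg hL, add_zero]

/-! ## §3 The pieces: interfacial / frustrated core pricing, the one-way debit, exactness -/

/-- piece ICP · WEAKER than DRP (proved `interfacialCorePricing_of_deepRigidPricing`) · TRUE-type on the zoo · UNDECIDED(test L3-REACH ∧ L3-RIG-deep)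
· IDEA-NEEDED (incompatibility pricing over the chart frames within reach; Read–Shockley, Lauteri–Luckhaus arXiv:1608.06155).
**Interfacial core pricing**: `κ` per deep-rigid compact gross charged motif site with crystal within reach `L`. -/
def InterfacialCorePricing (θ ε R r η L : ℝ) : Prop :=
  ∃ κ : ℝ, 0 < κ ∧ ∀ Q : PeriodicConfiguration 3, κ * (motifCoreInterfacial θ ε R r η L Q : ℝ) ≤ excess Q

/-- piece FCP · WEAKER than DRP (proved `frustratedCorePricing_of_deepRigidPricing`) · DECLARED SUB-RESIDUAL · BARRIER-ringed (`TetrahedralFrustration`,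
LocalCertificateBarrier) · UNDECIDED(test L3-NUC ∧ L3-REACH; conjecturally vacuous at `r = L = 10`) · INSTRUMENTABLE.
**Frustrated core pricing**: `κ` per deep-rigid compact gross charged motif site WITHOUT crystal within reach `L`. -/
def FrustratedCorePricing (θ ε R r η L : ℝ) : Prop :=
  ∃ κ : ℝ, 0 < κ ∧ ∀ Q : PeriodicConfiguration 3, κ * (motifCoreFrustrated θ ε R r η L Q : ℝ) ≤ excess Q

/-- piece IDP · WEAKER than ICP (proved, `C = 0`) · ENGINE-SHAPED: the certificate region «crystal + defects» may leak `C` per frustrated core ·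
exact partner of FCP (`deepRigidPricing_iff_debit_frustrated`).
**Interfacial debit pricing**: `κ` per interfacial core, up to the excess plus a debit `C` per frustrated core. -/
def InterfacialDebitPricing (θ ε R r η L : ℝ) : Prop :=
  ∃ κ C : ℝ, 0 < κ ∧ 0 ≤ C ∧ ∀ Q : PeriodicConfiguration 3,
    κ * (motifCoreInterfacial θ ε R r η L Q : ℝ) ≤ excess Q + C * (motifCoreFrustrated θ ε R r η L Q : ℝ)

/-- DRP is the pricing of the deep-rigid count (definitional). -/
theorem deepRigidPricing_iff_speciesPricing (θ ε R r η : ℝ) :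
    DeepRigidPricing θ ε R r η ↔ SpeciesPricing (motifCompactDeepRigid θ ε R r η) := Iff.rfl

/-- ICP is the pricing of the interfacial count (definitional). -/
theorem interfacialCorePricing_iff_speciesPricing (θ ε R r η L : ℝ) :
    InterfacialCorePricing θ ε R r η L ↔ SpeciesPricing (motifCoreInterfacial θ ε R r η L) := Iff.rfl

/-- FCP is the pricing of the frustrated count (definitional). -/
theorem frustratedCorePricing_iff_speciesPricing (θ ε R r η L : ℝ) :
    FrustratedCorePricing θ ε R r η L ↔ SpeciesPricing (motifCoreFrustrated θ ε R r η L) := Iff.rfl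

/-- ★ **THE REACH SPLIT OF THE RESIDUAL IS EXACT**: `DRP ⟺ FCP ∧ ICP`, every `θ ε R r η L`. -/
theorem deepRigidPricing_iff_frustrated_interfacial (θ ε R r η L : ℝ) :
    DeepRigidPricing θ ε R r η ↔ FrustratedCorePricing θ ε R r η L ∧ InterfacialCorePricing θ ε R r η L := by
  rw [deepRigidPricing_iff_speciesPricing,
    speciesPricing_congr (c' := fun Q => motifCoreFrustrated θ ε R r η L Q + motifCoreInterfacial θ ε R r η L Q)
      (fun Q => motifCompactDeepRigid_eq_frustrated_add_interfacial θ ε R r η L Q),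
    speciesPricing_add_iff]
  exact Iff.rfl

/-- ICP is weaker than the residual. -/
theorem interfacialCorePricing_of_deepRigidPricing {θ ε R r η : ℝ} (L : ℝ) (h : DeepRigidPricing θ ε R r η) :
    InterfacialCorePricing θ ε R r η L :=
  ((deepRigidPricing_iff_frustrated_interfacial θ ε R r η L).1 h).2

/-- FCP is weaker than the residual. -/
theorem frustratedCorePricing_of_deepRigidPricing {θ ε R r η : ℝ} (L : ℝ) (h : DeepRigidPricing θ ε R r η) :
    FrustratedCorePricing θ ε R r η L :=
  ((deepRigidPricing_iff_frustrated_interfacial θ ε R r η L).1 h).1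

/-- IDP is weaker than ICP (no debit needed). -/
theorem interfacialDebitPricing_of_interfacialCorePricing {θ ε R r η L : ℝ} (h : InterfacialCorePricing θ ε R r η L) :
    InterfacialDebitPricing θ ε R r η L := by
  obtain ⟨κ, hκ, h⟩ := h
  exact ⟨κ, 0, hκ, le_rfl, fun Q => by rw [zero_mul, add_zero]; exact h Q⟩

/-- ★★ **THE ONE-WAY DEBIT CLOSES**: interfacial cores priced up to a debit per frustrated core, and frustrated cores priced debit-free,
price the interfacial cores debit-free — constant `κκ'/(κ' + C)`. -/
theorem interfacialCorePricing_of_debit_frustrated {θ ε R r η L : ℝ} (hD : InterfacialDebitPricing θ ε R r η L)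
    (hF : FrustratedCorePricing θ ε R r η L) : InterfacialCorePricing θ ε R r η L := by
  obtain ⟨κ, C, hκ, hC, hD⟩ := hD
  obtain ⟨κ', hκ', hF⟩ := hF
  have hpos : 0 < κ' + C := by positivity
  refine ⟨κ * κ' / (κ' + C), by positivity, fun Q => ?_⟩
  have h1 := hD Q
  have h2 := hF Q
  rw [div_mul_eq_mul_div, div_le_iff₀ hpos]
  linarith [mul_le_mul_of_nonneg_left h1 hκ'.le, mul_le_mul_of_nonneg_left h2 hC]

/-- ★ The residual from the two engine pieces: `IDP → FCP → DRP`. -/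
theorem deepRigidPricing_of_debit_frustrated {θ ε R r η L : ℝ} (hD : InterfacialDebitPricing θ ε R r η L)
    (hF : FrustratedCorePricing θ ε R r η L) : DeepRigidPricing θ ε R r η :=
  (deepRigidPricing_iff_frustrated_interfacial θ ε R r η L).2 ⟨hF, interfacialCorePricing_of_debit_frustrated hD hF⟩

/-- ★★ **THE DEBIT SPLIT IS EXACT**: `DRP ⟺ IDP ∧ FCP`, every `θ ε R r η L`. -/
theorem deepRigidPricing_iff_debit_frustrated (θ ε R r η L : ℝ) :
    DeepRigidPricing θ ε R r η ↔ InterfacialDebitPricing θ ε R r η L ∧ FrustratedCorePricing θ ε R r η L :=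
  ⟨fun h => ⟨interfacialDebitPricing_of_interfacialCorePricing (interfacialCorePricing_of_deepRigidPricing L h),
    frustratedCorePricing_of_deepRigidPricing L h⟩, fun h => deepRigidPricing_of_debit_frustrated h.1 h.2⟩

/-- The reach dial on ICP: a larger reach prices more sites (antitone). -/
theorem interfacialCorePricing_anti {θ ε R r η L L' : ℝ} (h : L ≤ L') (hI : InterfacialCorePricing θ ε R r η L') :
    InterfacialCorePricing θ ε R r η L :=
  SpeciesPricing.mono hI fun Q => motifCoreInterfacial_mono h Q

/-- The reach dial on FCP: a larger reach prices fewer sites (monotone). -/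
theorem frustratedCorePricing_mono {θ ε R r η L L' : ℝ} (h : L ≤ L') (hF : FrustratedCorePricing θ ε R r η L) :
    FrustratedCorePricing θ ε R r η L' :=
  SpeciesPricing.mono hF fun Q => motifCoreFrustrated_anti h Q

/-- The reach dial on IDP: antitone (more sites to price, fewer to debit). -/
theorem interfacialDebitPricing_anti {θ ε R r η L L' : ℝ} (h : L ≤ L') (hD : InterfacialDebitPricing θ ε R r η L') :
    InterfacialDebitPricing θ ε R r η L := by
  obtain ⟨κ, C, hκ, hC, hD⟩ := hD
  refine ⟨κ, C, hκ, hC, fun Q => ?_⟩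
  have h1 : (motifCoreInterfacial θ ε R r η L Q : ℝ) ≤ motifCoreInterfacial θ ε R r η L' Q :=
    Nat.cast_le.2 (motifCoreInterfacial_mono h Q)
  have h2 : (motifCoreFrustrated θ ε R r η L' Q : ℝ) ≤ motifCoreFrustrated θ ε R r η L Q :=
    Nat.cast_le.2 (motifCoreFrustrated_anti h Q)
  calc κ * (motifCoreInterfacial θ ε R r η L Q : ℝ) ≤ κ * (motifCoreInterfacial θ ε R r η L' Q : ℝ) :=
        mul_le_mul_of_nonneg_left h1 hκ.le
    _ ≤ excess Q + C * (motifCoreFrustrated θ ε R r η L' Q : ℝ) := hD Q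
    _ ≤ excess Q + C * (motifCoreFrustrated θ ε R r η L Q : ℝ) := by
        linarith [mul_le_mul_of_nonneg_left h2 hC]

/-- Dial end: within a negative reach ICP holds trivially … -/
theorem interfacialCorePricing_of_neg {θ ε R r η L : ℝ} (hL : L < 0) : InterfacialCorePricing θ ε R r η L :=
  ⟨1, one_pos, fun Q => by rw [motifCoreInterfacial_eq_zero_of_neg hL, Nat.cast_zero, mul_zero]; exact excess_nonneg' Q⟩

/-- … and FCP is the whole residual. -/
theorem frustratedCorePricing_iff_deepRigidPricing_of_neg {θ ε R r η L : ℝ} (hL : L < 0) :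
    FrustratedCorePricing θ ε R r η L ↔ DeepRigidPricing θ ε R r η := by
  rw [frustratedCorePricing_iff_speciesPricing, deepRigidPricing_iff_speciesPricing,
    speciesPricing_congr (c := motifCoreFrustrated θ ε R r η L) (c' := motifCompactDeepRigid θ ε R r η)
      (fun Q => motifCoreFrustrated_eq_of_neg hL Q)]

/-- FCP for a non-positive gain is trivial (no deep-rigid site at all, part F-B). -/
theorem frustratedCorePricing_of_nonpos {θ ε R r η : ℝ} (hη : η ≤ 0) (L : ℝ) : FrustratedCorePricing θ ε R r η L :=
  frustratedCorePricing_of_deepRigidPricing L (deepRigidPricing_of_nonpos hη)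

/-! ## §4 Cones by name, regime ends of the sub-residual, the record `r = 10`, `L = 40` -/

/-- `ChargedEnergyGap` from the exposure piece, IP, the two reach pieces and the P-side. -/
theorem chargedEnergyGap_of_reachDial {θ ε R r η L : ℝ} (hE : ExposedGrossPricing θ ε R) (hI : ImprovablePricing θ ε R r η)
    (hD : InterfacialDebitPricing θ ε R r η L) (hF : FrustratedCorePricing θ ε R r η L) (hP : ChartedChargePricing θ) :
    ChargedEnergyGap :=
  chargedEnergyGap_of_deepRigidity hE hI (deepRigidPricing_of_debit_frustrated hD hF) hP

/-- The regime dial on the sub-residual: FCP ⟺ dense ∧ dilute, for every `φ₀`. -/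
theorem frustratedCorePricing_iff_dense_dilute (θ ε R r η L φ₀ : ℝ) :
    FrustratedCorePricing θ ε R r η L ↔
      DensePricing (motifCoreFrustrated θ ε R r η L) φ₀ ∧ DilutePricing (motifCoreFrustrated θ ε R r η L) φ₀ :=
  speciesPricing_iff_dense_dilute _ φ₀

/-- The dense end of FCP is below the dense end of DRP (antitone in the species), every `θ ε R r η L φ₀`. -/
theorem universalCompetitor_frustrated_of_deepRigid {θ ε R r η φ₀ : ℝ} (L : ℝ)
    (h : UniversalCompetitor (motifCompactDeepRigid θ ε R r η) φ₀) : UniversalCompetitor (motifCoreFrustrated θ ε R r η L) φ₀ :=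
  h.anti fun Q => motifCoreFrustrated_le θ ε R r η L Q

/-- `ChargedEnergyGap` from the exposure piece, IP, IDP, the two regime ends of FCP and the P-side. -/
theorem chargedEnergyGap_of_reachDial_regime {θ ε R r η L φ₀ : ℝ} (hE : ExposedGrossPricing θ ε R)
    (hI : ImprovablePricing θ ε R r η) (hD : InterfacialDebitPricing θ ε R r η L)
    (hU : UniversalCompetitor (motifCoreFrustrated θ ε R r η L) φ₀) (hDil : DilutePricing (motifCoreFrustrated θ ε R r η L) φ₀)
    (hP : ChartedChargePricing θ) : ChargedEnergyGap :=
  chargedEnergyGap_of_reachDial hE hI hD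
    ((frustratedCorePricing_iff_dense_dilute θ ε R r η L φ₀).2 ⟨densePricing_of_universalCompetitor hU, hDil⟩) hP

/-- ★★ **THE WHOLE GROSS SIDE AT THE RECORD**: `[G] GrossChargeGap (3/20) ⟺ IP ∧ IDP ∧ FCP` at
`(ε, R, r, η, L) = (1/10, 6/5, 10, 1/100, 40)` (the exposed piece is the tree's `exposedGrossPricing_record`). -/
theorem grossChargeGap_iff_improvable_debit_frustrated_record :
    GrossChargeGap (3 / 20) ↔
      ImprovablePricing (3 / 20) (1 / 10) (6 / 5) 10 (1 / 100) ∧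
        InterfacialDebitPricing (3 / 20) (1 / 10) (6 / 5) 10 (1 / 100) 40 ∧
          FrustratedCorePricing (3 / 20) (1 / 10) (6 / 5) 10 (1 / 100) 40 := by
  rw [grossChargeGap_iff_improvable_deepRigid_record, deepRigidPricing_iff_debit_frustrated _ _ _ _ _ 40]

/-- ★ **RECORD CONE `r = 10`, `L = 40`**, FIVE leaves: `ChargedEnergyGap` from IP · IDP · UC(frustrated cores, dense) · DP(frustrated cores,
dilute) · P-side at `(θ, ε, R, r, η, L, φ₀) = (3/20, 1/10, 6/5, 10, 1/100, 40, 1/100)`. -/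
theorem chargedEnergyGap_of_reachDial_record (hI : ImprovablePricing (3 / 20) (1 / 10) (6 / 5) 10 (1 / 100))
    (hD : InterfacialDebitPricing (3 / 20) (1 / 10) (6 / 5) 10 (1 / 100) 40)
    (hU : UniversalCompetitor (motifCoreFrustrated (3 / 20) (1 / 10) (6 / 5) 10 (1 / 100) 40) (1 / 100))
    (hDil : DilutePricing (motifCoreFrustrated (3 / 20) (1 / 10) (6 / 5) 10 (1 / 100) 40) (1 / 100))
    (hP : ChartedChargePricing (3 / 20)) : ChargedEnergyGap :=
  chargedEnergyGap_of_reachDial_regime exposedGrossPricing_record hI hD hU hDil hP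

/-- The same cone with ICP in place of IDP (debit-free form). -/
theorem chargedEnergyGap_of_reachDial_recordSplit (hI : ImprovablePricing (3 / 20) (1 / 10) (6 / 5) 10 (1 / 100))
    (hC : InterfacialCorePricing (3 / 20) (1 / 10) (6 / 5) 10 (1 / 100) 40)
    (hF : FrustratedCorePricing (3 / 20) (1 / 10) (6 / 5) 10 (1 / 100) 40)
    (hP : ChartedChargePricing (3 / 20)) : ChargedEnergyGap :=
  chargedEnergyGap_of_deepRigidity exposedGrossPricing_record hI
    ((deepRigidPricing_iff_frustrated_interfacial _ _ _ _ _ 40).2 ⟨hF, hC⟩) hP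

/-- WEAKER certificates: each reach piece is implied by the crux (via the compact gap and part F-B). -/
theorem interfacialDebitPricing_of_chargedEnergyGap (θ ε R r η L : ℝ) (h : ChargedEnergyGap) :
    InterfacialDebitPricing θ ε R r η L :=
  interfacialDebitPricing_of_interfacialCorePricing
    (interfacialCorePricing_of_deepRigidPricing L (deepRigidPricing_of_compactGrossGap r η (compactGrossGap_of_chargedEnergyGap θ ε R h)))

/-- The crux `ChargedEnergyGap` yields `FrustratedCorePricing` at every parameter (via compact gross gap and deep-rigid pricing). [formal bookkeeping] -/
theorem frustratedCorePricing_of_chargedEnergyGap (θ ε R r η L : ℝ) (h : ChargedEnergyGap) : FrustratedCorePricing θ ε R r η L :=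
  frustratedCorePricing_of_deepRigidPricing L (deepRigidPricing_of_compactGrossGap r η (compactGrossGap_of_chargedEnergyGap θ ε R h))

/-- The crux `ChargedEnergyGap` yields the universal competitor for the frustrated-core motif at the record parameters. [formal bookkeeping] -/
theorem universalCompetitor_frustrated_record_of_chargedEnergyGap (h : ChargedEnergyGap) :
    UniversalCompetitor (motifCoreFrustrated (3 / 20) (1 / 10) (6 / 5) 10 (1 / 100) 40) (1 / 100) := by
  have hD : DeepRigidPricing (3 / 20) (1 / 10) (6 / 5) 10 (1 / 100) :=
    deepRigidPricing_of_compactGrossGap 10 (1 / 100) (compactGrossGap_of_chargedEnergyGap (3 / 20) (1 / 10) (6 / 5) h)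
  exact universalCompetitor_frustrated_of_deepRigid 40
    (universalCompetitor_of_densePricing (by norm_num) ((deepRigidPricing_iff_dense_dilute _ _ _ _ _ (1 / 100)).1 hD).1)

/-- Bridge between the two residual records of part F-B on the sub-residual: FCP at `r = 10` gives FCP at `r = 20` (same reach). -/
theorem frustratedCorePricing_r20_of_r10 {θ ε R η L : ℝ} (h : FrustratedCorePricing θ ε R 10 η L) :
    FrustratedCorePricing θ ε R 20 η L :=
  SpeciesPricing.mono h fun Q =>
    Nat.card_le_card_of_injective
      (fun x => ⟨x.1, ⟨⟨x.2.1.1.1, fun h0 => x.2.1.1.2 (h0.mono (by norm_num) le_rfl)⟩,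
        fun h0 => x.2.1.2 (h0.mono (by norm_num) le_rfl)⟩, x.2.2⟩)
      fun _ _ hab => Subtype.ext (Subtype.mk.inj hab)

end Summit.AtomisticToContinuum.Crystallization.Theorems.ChargedEnergyGapChartDial

end
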